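import Summits.CriticalPhenomena.PercolationContinuityZ3.Theorems.PercNearOneGluingNoHeavyQuantFarRelayRowStar
import HarnessLib

/-!
# QUANT lane R8 tool: the TWO-THRESHOLD transport row for independent blobs with gates `≥ 1/2`
# (`p₀ · P(X < λ) ≤ (1 − p₀) · P(X ≥ η)` whenever `λ + η ≤ Σ a`)

builds on p205010 (kernel theorem, internal audit signed; external expert review pending)

Support file (`--supports stmt-CriticalPhenomena-4575`), QUANT lane seat prim-quant-p1 (gen 7); memo `run/shared/lean/prim/quant/P1-SURPLUS.md`
§18.7–18.8.  Theorems only; no sorries; standard axioms.  Companion of `…QuantIndepBlobFar.lean` (lead g5: `Quant.IndepBlob.exists_injective_heavy_superset`,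
`weight_transport`, and `halfMean_smallBall_of_half_le_gate` = the case `λ + η = m − a₀ + …` of this file's row).

**Why.**  The light-block cell of FAR on 'hub + leaves + root blocks' ([MTL]; `Quant.HubBlocksProfileIneq`) is, exactly, a one-dimensional moment
inequality `E[f̂(B)] ≤ 0` for the independent block sum `B` against a nonincreasing profile `f̂` (memo §18.8); an exact LP shows that it is certified
(883/883 sampled instances with a light block) by nonnegative combinations of block-star rows and of TWO-THRESHOLD ("gap") rows
`x·P(B ≤ ℓ−1) ≤ (1−x)·P(B ≥ h+1)` (`ℓ ≤ h`).  This file proves the gap row in the regime where every gate is `≥ 1/2`, where — exactly as in the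
Hall–Harris half of the half-mean small-ball inequality — only the TOTAL weight matters: the light sets inject into heavy supersets as soon as
`λ + η ≤ Σ a`, and opening gates of probability `≥ p₀ ≥ 1/2` multiplies the product weight by at least `p₀/(1 − p₀)`.

* `Quant.IndepBlob.gapRow_of_half_le_gate` — weights `a k ≥ 0`, gates `p₀ ≤ p k ≤ 1` with `p₀ ≥ 1/2`, thresholds `λ + η ≤ Σ_k a k`:
  `p₀ · Σ_{W : a(W) < λ} w(W) ≤ (1 − p₀) · Σ_{V : η ≤ a(V)} w(V)` (`w` the product weight).
* `Quant.IndepBlob.prodBernoulli_gapRow_of_half_le_gate` — the same for `prodBernoulli p` on a finite type (`p y ≤ p k`, `1/2 ≤ p y`):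
  `p y · P(Σ_{k∈ω} a k < λ) ≤ (1 − p y) · P(η ≤ Σ_{k∈ω} a k)`.
Numerics (memo §18.7): for integer blobs the row `x P(B ≤ ℓ−1) ≤ (1−x) P(B ≥ h+1)` holds under the MEAN hypothesis `EB > ℓ + h − x` for all `x` (134 398 exact
instances, 102 044 with `x < 1/2`, 0 violations); the `x < 1/2` half is not proved here.  [this work]
-/

namespace Summit.CriticalPhenomena.PercolationContinuityZ3.Theorems

namespace Quant

namespace IndepBlob

open Finset

variable {ι : Type*} [Fintype ι] [DecidableEq ι]

/-- **Two-threshold transport row, all gates `≥ 1/2`.**  For weights `a k ≥ 0`, gates `p₀ ≤ p k ≤ 1` with `1/2 ≤ p₀`, and thresholds with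
`λ + η ≤ Σ_k a k`: `p₀ · Σ_{W : a(W) < λ} ∏(…) ≤ (1 − p₀) · Σ_{V : η ≤ a(V)} ∏(…)` — the light sets inject into heavy supersets
(`exists_injective_heavy_superset`) and each injection step gains the factor `p₀/(1 − p₀)` (`weight_transport`). [this work] -/
theorem gapRow_of_half_le_gate (p a : ι → ℝ) (p₀ : ℝ) (hhalf : 1 / 2 ≤ p₀) (hp₀1 : p₀ ≤ 1) (hp : ∀ i, p₀ ≤ p i)
    (hp1 : ∀ i, p i ≤ 1) (ha : ∀ i, 0 ≤ a i) (lam eta : ℝ) (hlam : lam ≤ eta) (hle : lam + eta ≤ ∑ i, a i) :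
    p₀ * (∑ W ∈ (Finset.univ : Finset (Finset ι)).filter (fun W => ∑ i ∈ W, a i < lam),
        (∏ k, if k ∈ W then p k else 1 - p k)) ≤
      (1 - p₀) * (∑ V ∈ (Finset.univ : Finset (Finset ι)).filter (fun V => eta ≤ ∑ i ∈ V, a i),
        (∏ k, if k ∈ V then p k else 1 - p k)) := by
  have hp₀ : 0 ≤ p₀ := by linarith
  have hf0 : 0 ≤ 1 - p₀ := by linarith
  have hw0 : ∀ W, 0 ≤ (∏ k, if k ∈ W then p k else 1 - p k) := bernoulliWeight_nonneg (fun i => hp₀.trans (hp i)) hp1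
  obtain ⟨φ, hφinj, hφ⟩ := exists_injective_heavy_superset a ha lam eta hle
  -- the light sum, re-indexed by the subtype
  have hLeq : ∑ W ∈ (Finset.univ : Finset (Finset ι)).filter (fun W => ∑ i ∈ W, a i < lam), (∏ k, if k ∈ W then p k else 1 - p k) =
      ∑ W : {W : Finset ι // ∑ i ∈ W, a i < lam}, (∏ k, if k ∈ (W : Finset ι) then p k else 1 - p k) := by
    refine Finset.sum_subtype _ (fun W => ?_) _
    rw [Finset.mem_filter]
    exact ⟨fun hW => hW.2, fun hW => ⟨Finset.mem_univ _, hW⟩⟩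
  -- transport term by term: `W ⊊ φ W` because `a(W) < λ ≤ η ≤ a(φ W)`
  have hstep : ∀ W : {W : Finset ι // ∑ i ∈ W, a i < lam},
      p₀ * (∏ k, if k ∈ (W : Finset ι) then p k else 1 - p k) ≤ (1 - p₀) * (∏ k, if k ∈ φ W then p k else 1 - p k) := by
    intro W
    refine weight_transport hhalf hp hp1 (hφ W).1 fun hWφ => ?_
    have h1 : eta ≤ ∑ i ∈ φ W, a i := (hφ W).2
    have h2 : ∑ i ∈ (W : Finset ι), a i < lam := W.2
    rw [← hWφ] at h1
    linarith
  have hsum : p₀ * ∑ W : {W : Finset ι // ∑ i ∈ W, a i < lam}, (∏ k, if k ∈ (W : Finset ι) then p k else 1 - p k) ≤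
      (1 - p₀) * ∑ W : {W : Finset ι // ∑ i ∈ W, a i < lam}, (∏ k, if k ∈ φ W then p k else 1 - p k) := by
    rw [Finset.mul_sum, Finset.mul_sum]
    exact Finset.sum_le_sum fun W _ => hstep W
  -- the image of `φ` lies in the heavy sets, injectively
  have himage : ∑ W : {W : Finset ι // ∑ i ∈ W, a i < lam}, (∏ k, if k ∈ φ W then p k else 1 - p k) ≤
      ∑ V ∈ (Finset.univ : Finset (Finset ι)).filter (fun V => eta ≤ ∑ i ∈ V, a i), (∏ k, if k ∈ V then p k else 1 - p k) := by
    rw [← Finset.sum_image (f := fun V : Finset ι => ∏ k, if k ∈ V then p k else 1 - p k) (s := Finset.univ) (g := φ)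
      fun x _ y _ hxy => hφinj hxy]
    refine Finset.sum_le_sum_of_subset_of_nonneg (fun V hV => ?_) fun V _ _ => hw0 V
    rw [Finset.mem_image] at hV
    obtain ⟨W, -, rfl⟩ := hV
    rw [Finset.mem_filter]
    exact ⟨Finset.mem_univ _, (hφ W).2⟩
  rw [hLeq]
  exact hsum.trans (mul_le_mul_of_nonneg_left himage hf0)

open scoped Classical in
omit [DecidableEq ι] in
/-- **Two-threshold transport row for `prodBernoulli`** (all gates `≥ 1/2`).  For `p : ι → [0,1]` on a finite type with a least reliable
coordinate `y`, `1/2 ≤ p y ≤ p k`, weights `a k ≥ 0` and thresholds `λ ≤ η` with `λ + η ≤ Σ_k a k`: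
`p y · P(Σ_{k∈ω} a k < λ) ≤ (1 − p y) · P(η ≤ Σ_{k∈ω} a k)`. [this work] -/
theorem prodBernoulli_gapRow_of_half_le_gate (p : ι → unitInterval) (a : ι → ℝ) (ha : ∀ k, 0 ≤ a k) (y : ι)
    (hy : ∀ k, p y ≤ p k) (hhalf : (1 : ℝ) / 2 ≤ ((p y : unitInterval) : ℝ)) (lam eta : ℝ) (hlam : lam ≤ eta)
    (hle : lam + eta ≤ ∑ k, a k) :
    ((p y : unitInterval) : ℝ) *
        (Literature.Probability.LatticeModels.prodBernoulli p).real
          {ω : Set ι | ∑ k ∈ (Finset.univ : Finset ι).filter (fun k => k ∈ ω), a k < lam} ≤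
      (1 - ((p y : unitInterval) : ℝ)) *
        (Literature.Probability.LatticeModels.prodBernoulli p).real
          {ω : Set ι | eta ≤ ∑ k ∈ (Finset.univ : Finset ι).filter (fun k => k ∈ ω), a k} := by
  rw [prodBernoulli_real_eq_sum_finset, prodBernoulli_real_eq_sum_finset]
  have hP1 : ∀ k, ((p k : unitInterval) : ℝ) ≤ 1 := fun k => (p k).2.2
  have hy' : ∀ k, ((p y : unitInterval) : ℝ) ≤ ((p k : unitInterval) : ℝ) := fun k => by exact_mod_cast hy k
  have key := gapRow_of_half_le_gate (fun k => ((p k : unitInterval) : ℝ)) a ((p y : unitInterval) : ℝ) hhalf (hP1 y) hy' hP1 ha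
    lam eta hlam hle
  convert key using 2
  · refine Finset.sum_congr (Finset.filter_congr fun s _ => ?_) fun _ _ => ?_
    · simp only [Set.mem_setOf_eq, Finset.sum_filter, Finset.mem_coe, Finset.sum_ite_mem, Finset.univ_inter]
    · exact Finset.prod_congr rfl fun k _ => by congr 1
  · refine Finset.sum_congr (Finset.filter_congr fun s _ => ?_) fun _ _ => ?_
    · simp only [Set.mem_setOf_eq, Finset.sum_filter, Finset.mem_coe, Finset.sum_ite_mem, Finset.univ_inter]
    · exact Finset.prod_congr rfl fun k _ => by congr 1

end IndepBlob

end Quant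

end Summit.CriticalPhenomena.PercolationContinuityZ3.Theorems
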